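import Mathlib
import Literature.NumberTheory.Transcendental.SemialgebraicMapsProofs
import Literature.NumberTheory.Transcendental.SemialgebraicLineDeriv
import Summits.KontsevichZagierPeriods.KontsevichZagierPeriods.Theorems.TorsionLogsNeronTorsionSectorStubHaarReps
import HarnessLib

/-!
# Stub `stub_cornerChartLower` — crux `TorsionLogs.NeronTorsionSector`, line `registered` (block W1)

The compactifying chart `s = x^{-1/2}` (`x = s⁻²`) at the point at infinity of the real curve
`y² = f(x) = 4x³ − g₂x − g₃`, lower branch `y = −√f(x)`, translated by the algebraic point
`P₁ = (x₁, y₁)`, `y₁ < 0`. With `R(s) = √(4 − g₂s⁴ − g₃s⁶) = s³√f(s⁻²)`, `M̂(s) = s⁴M(s⁻²)`,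
`Dl = R − y₁s³` and the junk-free numerators `Ñ`, `A₁`, `K̂` of the statement, we prove:

1. on `0 < s ≤ s₁` the `s`-chart formulas agree with the `x`-chart formulas at `x = s⁻²`
   (pure algebra: the key polynomial identities `M̂² − 4Dl² = s²Ñ`, `R·Dl − M̂ = s²A₁`,
   `s⁵·Pg(s⁻²) = K̂`, using `R² = 4 − g₂s⁴ − g₃s⁶` and `y₁² = f(x₁)`);
2. continuity of `R`, `τ̂`, `Q̂`, `Ĝ` on `[0, s₁]` (`Dl > 0` there, `τ̂ > 0` by hypothesis, and the
   lower-branch translation `τ` is continuous on all of `ℝ` since `−√f + y₁ ≤ y₁ < 0`);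
3. the values at `s = 0`;
4. `ℚ`-semialgebraicity on the slab `{t | t 0 ∈ [0, s₁]}` by the closure rules for real
   semialgebraic functions (Bochnak–Coste–Roy, Prop. 2.2.6).

References: M. Kontsevich, D. Zagier, *Periods* (2001), §1.2; J. H. Silverman, *The Arithmetic of
Elliptic Curves* (2009), III.2.3; J. Bochnak, M. Coste, M.-F. Roy, *Real Algebraic Geometry* (1998),
Prop. 2.2.6.
-/

noncomputable section

-- `Summit.KontsevichZagierPeriods.KontsevichZagierPeriods.…` is the tree's mandated layout (single-conjunct summit).
set_option linter.dupNamespace false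

open Set
open Literature.NumberTheory.Transcendental Literature.ModelTheory.ExponentialFields

namespace Summit.KontsevichZagierPeriods.KontsevichZagierPeriods.Cruxes.NeronTorsionSector.Translation

/-- The closed slab `{z ∈ ℝ¹ | a ≤ z 0 ≤ b}` with real algebraic ends is `ℚ`-semialgebraic.
[cite: BochnakCosteRoy1998, §2.1] -/
theorem cornerLower_isSemialgebraic_slab {a b : ℝ} (ha : IsAlgebraic ℚ a)
    (hb : IsAlgebraic ℚ b) : IsSemialgebraic ℚ {z : Fin 1 → ℝ | z 0 ∈ Set.Icc a b} := by
  -- adapted from `ellTransRel_isSemialgebraic_slab` (UnfoldedStokes … EllipticTranslationRelator)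
  have h : {z : Fin 1 → ℝ | z 0 ∈ Set.Icc a b} =
      {z : Fin 1 → ℝ | z 0 < a}ᶜ ∩ {z : Fin 1 → ℝ | b < z 0}ᶜ := by
    ext z
    simp [not_lt]
  rw [h]
  exact (KZ.isSemialgebraic_setOf_apply_lt_const ha 0).compl.inter
    (KZ.isSemialgebraic_setOf_const_lt_apply hb 0).compl

/-- **STUB W1 (`stub_cornerChartLower`) — the compactifying chart `s = x^{-1/2}` at the point at
infinity, lower branch.** With `R(s) = √(4 − g₂s⁴ − g₃s⁶)` (= `s³√f(s⁻²)`), `M̂(s) = s⁴M(s⁻²)`,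
`Dl = R − y₁s³`, `Ñ(s) = 32x₁ + 4(12x₁² − g₂)s² + 8y₁sR + (16x₁³ − 4g₂x₁ + 8g₃)s⁴ + (4x₁² − g₂)²s⁶`: the
lower-branch translation is `τ̂ = Ñ/(4Dl²) − x₁` (junk-free at `s = 0`, value `x₁`), the third-kind potential
is `Q̂ = s·A₁/(2Dl) − √f(τ̂)/(2τ̂)`, `A₁ = −4x₁ − y₁sR − 4x₁²s² − g₃s⁴` (value `y₁/(2x₁)` at `s = 0`), and the
dlog potential is `Ĝs = K̂·√(τ(τ̂ s))/(Dl²·τ̂)`, `K̂ = −4R − L₁sM̂ − 8x₁s²R + 4y₁s³ + 8x₁y₁s⁵` (value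
`−2√(τ x₁)/x₁`). Conclusions: agreement with the x-chart formulas composed with `x = s⁻²` on `s > 0`
(the polynomial identities `M̂² − 4Dl² = s²Ñ`, `R·Dl − M̂ = s²A₁`, `s⁵Pg(s⁻²) = K̂`), continuity on `[0, s₁]`,
the values at `0`, and `ℚ`-semialgebraicity (closure rules). [cite: KontsevichZagier2001, §1.2 rule (2)]
[cite: SilvermanAEC2009, III.2.3] [cite: BochnakCosteRoy1998, Prop. 2.2.6] -/
theorem stub_cornerChartLower :
    ∀ (g₂ g₃ x₁ y₁ L₁ s₁ : ℝ) (f yb sl τ Pg R Mh Dl Nt τh A₁ Qh Kh Gs : ℝ → ℝ),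
    (∀ x, f x = 4 * x ^ 3 - g₂ * x - g₃) → y₁ ^ 2 = f x₁ → y₁ < 0 → 0 < x₁ → 0 < s₁ → s₁ ^ 2 * x₁ = 1 →
    L₁ = (12 * x₁ ^ 2 - g₂) / (2 * y₁) →
    IsAlgebraic ℚ g₂ → IsAlgebraic ℚ g₃ → IsAlgebraic ℚ x₁ → IsAlgebraic ℚ y₁ →
    yb = (fun x => -Real.sqrt (f x)) →
    sl = (fun x => (4 * x ^ 2 + 4 * x * x₁ + 4 * x₁ ^ 2 - g₂) / (yb x + y₁)) →
    τ = (fun x => sl x ^ 2 / 4 - x - x₁) →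
    Pg = (fun x => 4 * (x + 2 * x₁) * y₁ - L₁ * (4 * x ^ 2 + 4 * x * x₁ + 4 * x₁ ^ 2 - g₂)
      + 4 * (x + 2 * x₁) * yb x) →
    R = (fun s => Real.sqrt (4 - g₂ * s ^ 4 - g₃ * s ^ 6)) →
    Mh = (fun s => 4 + 4 * x₁ * s ^ 2 + (4 * x₁ ^ 2 - g₂) * s ^ 4) →
    Dl = (fun s => R s - y₁ * s ^ 3) →
    Nt = (fun s => 32 * x₁ + 4 * (12 * x₁ ^ 2 - g₂) * s ^ 2 + 8 * y₁ * s * R s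
      + (16 * x₁ ^ 3 - 4 * g₂ * x₁ + 8 * g₃) * s ^ 4 + (4 * x₁ ^ 2 - g₂) ^ 2 * s ^ 6) →
    τh = (fun s => Nt s / (4 * Dl s ^ 2) - x₁) →
    A₁ = (fun s => -4 * x₁ - y₁ * s * R s - 4 * x₁ ^ 2 * s ^ 2 - g₃ * s ^ 4) →
    Qh = (fun s => s * A₁ s / (2 * Dl s) - Real.sqrt (f (τh s)) / (2 * τh s)) →
    Kh = (fun s => -4 * R s - L₁ * s * Mh s - 8 * x₁ * s ^ 2 * R s + 4 * y₁ * s ^ 3 + 8 * x₁ * y₁ * s ^ 5) →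
    Gs = (fun s => Kh s * Real.sqrt (τ (τh s)) / (Dl s ^ 2 * τh s)) →
    (∀ s ∈ Set.Icc 0 s₁, 0 < 4 - g₂ * s ^ 4 - g₃ * s ^ 6) →
    (∀ s ∈ Set.Icc 0 s₁, 0 < τh s ∧ 0 < f (τh s) ∧ 0 < τ (τh s)) →
    (∀ s, 0 < s → s ≤ s₁ →
      Real.sqrt (f (s ^ 2)⁻¹) = R s / s ^ 3 ∧ τh s = τ (s ^ 2)⁻¹ ∧ 0 < Dl s ∧
      Qh s = sl (s ^ 2)⁻¹ / 2 - yb (s ^ 2)⁻¹ / (2 * (s ^ 2)⁻¹) - Real.sqrt (f (τ (s ^ 2)⁻¹)) / (2 * τ (s ^ 2)⁻¹) ∧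
      Gs s = Pg (s ^ 2)⁻¹ / (yb (s ^ 2)⁻¹ + y₁) ^ 2 * Real.sqrt ((s ^ 2)⁻¹ * τ (τ (s ^ 2)⁻¹)) / τ (s ^ 2)⁻¹) ∧
    (ContinuousOn R (Set.Icc 0 s₁) ∧ ContinuousOn τh (Set.Icc 0 s₁) ∧ ContinuousOn Qh (Set.Icc 0 s₁) ∧
      ContinuousOn Gs (Set.Icc 0 s₁)) ∧
    (R 0 = 2 ∧ τh 0 = x₁ ∧ Qh 0 = y₁ / (2 * x₁) ∧ Gs 0 = -2 * Real.sqrt (τ x₁) / x₁ ∧ Dl 0 = 2) ∧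
    (IsSemialgebraicFunOn ℚ {t : Fin 1 → ℝ | t 0 ∈ Set.Icc 0 s₁} (fun t => R (t 0)) ∧
      IsSemialgebraicFunOn ℚ {t : Fin 1 → ℝ | t 0 ∈ Set.Icc 0 s₁} (fun t => τh (t 0)) ∧
      IsSemialgebraicFunOn ℚ {t : Fin 1 → ℝ | t 0 ∈ Set.Icc 0 s₁} (fun t => Qh (t 0)) ∧
      IsSemialgebraicFunOn ℚ {t : Fin 1 → ℝ | t 0 ∈ Set.Icc 0 s₁} (fun t => Gs (t 0))) := by
  intro g₂ g₃ x₁ y₁ L₁ s₁ f yb sl τ Pg R Mh Dl Nt τh A₁ Qh Kh Gs hf hy1 hy1n hx1 hs1 hs1x hL1 ag₂ ag₃ ax₁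
    ay₁ hyb hsl hτ hPg hR hMh hDl hNt hτh hA1 hQh hKh hGs hrad hτpos
  -- pointwise unfoldings of the defined functions
  have hf' : f = fun x => 4 * x ^ 3 - g₂ * x - g₃ := funext hf
  have hy1' : y₁ ^ 2 = 4 * x₁ ^ 3 - g₂ * x₁ - g₃ := by rw [hy1, hf]
  have hR' : ∀ s, R s = Real.sqrt (4 - g₂ * s ^ 4 - g₃ * s ^ 6) := fun s => by rw [hR]
  have hMh' : ∀ s, Mh s = 4 + 4 * x₁ * s ^ 2 + (4 * x₁ ^ 2 - g₂) * s ^ 4 := fun s => by rw [hMh]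
  have hDl' : ∀ s, Dl s = R s - y₁ * s ^ 3 := fun s => by rw [hDl]
  have hNt' : ∀ s, Nt s = 32 * x₁ + 4 * (12 * x₁ ^ 2 - g₂) * s ^ 2 + 8 * y₁ * s * R s
      + (16 * x₁ ^ 3 - 4 * g₂ * x₁ + 8 * g₃) * s ^ 4 + (4 * x₁ ^ 2 - g₂) ^ 2 * s ^ 6 := fun s => by
    rw [hNt]
  have hτh' : ∀ s, τh s = Nt s / (4 * Dl s ^ 2) - x₁ := fun s => by rw [hτh]
  have hA1' : ∀ s, A₁ s = -4 * x₁ - y₁ * s * R s - 4 * x₁ ^ 2 * s ^ 2 - g₃ * s ^ 4 := fun s => by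
    rw [hA1]
  have hQh' : ∀ s, Qh s = s * A₁ s / (2 * Dl s) - Real.sqrt (f (τh s)) / (2 * τh s) := fun s => by
    rw [hQh]
  have hKh' : ∀ s, Kh s = -4 * R s - L₁ * s * Mh s - 8 * x₁ * s ^ 2 * R s + 4 * y₁ * s ^ 3
      + 8 * x₁ * y₁ * s ^ 5 := fun s => by rw [hKh]
  have hGs' : ∀ s, Gs s = Kh s * Real.sqrt (τ (τh s)) / (Dl s ^ 2 * τh s) := fun s => by rw [hGs]
  have hyb' : ∀ x, yb x = -Real.sqrt (f x) := fun x => by rw [hyb]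
  have hsl' : ∀ x, sl x = (4 * x ^ 2 + 4 * x * x₁ + 4 * x₁ ^ 2 - g₂) / (yb x + y₁) := fun x => by
    rw [hsl]
  have hτ' : ∀ x, τ x = sl x ^ 2 / 4 - x - x₁ := fun x => by rw [hτ]
  have hPg' : ∀ x, Pg x = 4 * (x + 2 * x₁) * y₁ - L₁ * (4 * x ^ 2 + 4 * x * x₁ + 4 * x₁ ^ 2 - g₂)
      + 4 * (x + 2 * x₁) * yb x := fun x => by rw [hPg]
  -- basic sign information
  have hRpos : ∀ s ∈ Icc (0:ℝ) s₁, 0 < R s := fun s hs => by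
    rw [hR']; exact Real.sqrt_pos.2 (hrad s hs)
  have hR2 : ∀ s ∈ Icc (0:ℝ) s₁, R s ^ 2 = 4 - g₂ * s ^ 4 - g₃ * s ^ 6 := fun s hs => by
    rw [hR']; exact Real.sq_sqrt (hrad s hs).le
  have hDlpos : ∀ s ∈ Icc (0:ℝ) s₁, 0 < Dl s := fun s hs => by
    rw [hDl']
    have h3 : 0 ≤ -y₁ * s ^ 3 := mul_nonneg (neg_nonneg.2 hy1n.le) (pow_nonneg hs.1 3)
    linarith [hRpos s hs]
  have hDne : ∀ s ∈ Icc (0:ℝ) s₁, Dl s ≠ 0 := fun s hs => (hDlpos s hs).ne'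
  have hτhne : ∀ s ∈ Icc (0:ℝ) s₁, τh s ≠ 0 := fun s hs => (hτpos s hs).1.ne'
  have hnegden : ∀ x, -Real.sqrt (f x) + y₁ ≠ 0 := fun x => by
    have := Real.sqrt_nonneg (f x); exact ne_of_lt (by linarith)
  have hybne : ∀ x, yb x + y₁ ≠ 0 := fun x => by rw [hyb']; exact hnegden x
  ---------------------------------------------------------------------------------------------
  -- (i) agreement with the x-chart on `0 < s ≤ s₁`
  ---------------------------------------------------------------------------------------------
  have part1 : ∀ s, 0 < s → s ≤ s₁ →
      Real.sqrt (f (s ^ 2)⁻¹) = R s / s ^ 3 ∧ τh s = τ (s ^ 2)⁻¹ ∧ 0 < Dl s ∧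
      Qh s = sl (s ^ 2)⁻¹ / 2 - yb (s ^ 2)⁻¹ / (2 * (s ^ 2)⁻¹)
        - Real.sqrt (f (τ (s ^ 2)⁻¹)) / (2 * τ (s ^ 2)⁻¹) ∧
      Gs s = Pg (s ^ 2)⁻¹ / (yb (s ^ 2)⁻¹ + y₁) ^ 2 * Real.sqrt ((s ^ 2)⁻¹ * τ (τ (s ^ 2)⁻¹))
        / τ (s ^ 2)⁻¹ := by
    intro s hs hs'
    have hsI : s ∈ Icc (0:ℝ) s₁ := ⟨hs.le, hs'⟩
    have hs0 : s ≠ 0 := hs.ne'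
    have hDs : 0 < Dl s := hDlpos s hsI
    have hDs0 : Dl s ≠ 0 := hDs.ne'
    have hths0 : τh s ≠ 0 := hτhne s hsI
    have hR2s := hR2 s hsI
    -- `√f(s⁻²) = R/s³`
    have h1 : Real.sqrt (f (s ^ 2)⁻¹) = R s / s ^ 3 := by
      have hx : f (s ^ 2)⁻¹ = (R s / s ^ 3) ^ 2 := by
        rw [hf, div_pow, hR2s]
        field_simp
      rw [hx, Real.sqrt_sq (div_nonneg (hRpos s hsI).le (pow_nonneg hs.le 3))]
    -- the key identity `M̂² − 4 Dl² = s² Ñ`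
    have hkey : Mh s ^ 2 - 4 * Dl s ^ 2 = s ^ 2 * Nt s := by
      rw [hMh', hDl', hNt']
      linear_combination (-4) * hR2s + (-4 * s ^ 6) * hy1'
    have hNt_eq : Nt s = (Mh s ^ 2 - 4 * Dl s ^ 2) / s ^ 2 := by
      rw [hkey, mul_div_cancel_left₀ _ (pow_ne_zero 2 hs0)]
    have hden : -(R s / s ^ 3) + y₁ = -Dl s / s ^ 3 := by
      rw [hDl']
      field_simp
      ring
    have h2 : τh s = τ (s ^ 2)⁻¹ := by
      rw [hτh', hNt_eq, hτ', hsl', hyb', h1, hden, hMh']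
      field_simp
      ring
    -- `R·Dl − M̂ = s² A₁`
    have hA1eq : A₁ s = (R s * Dl s - Mh s) / s ^ 2 := by
      rw [eq_div_iff (pow_ne_zero 2 hs0), hA1', hDl', hMh']
      linear_combination (-1) * hR2s
    have h4 : Qh s = sl (s ^ 2)⁻¹ / 2 - yb (s ^ 2)⁻¹ / (2 * (s ^ 2)⁻¹)
        - Real.sqrt (f (τ (s ^ 2)⁻¹)) / (2 * τ (s ^ 2)⁻¹) := by
      rw [← h2, hQh', hsl', hyb', h1, hden, hA1eq, hMh']
      congr 1
      field_simp
      ring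
    -- `√(x · X) = √X / s`
    have hsq : Real.sqrt ((s ^ 2)⁻¹ * τ (τh s)) = Real.sqrt (τ (τh s)) / s := by
      rw [Real.sqrt_mul (inv_nonneg.2 (sq_nonneg s)), Real.sqrt_inv, Real.sqrt_sq hs.le,
        inv_mul_eq_div]
    -- `s⁵ Pg(s⁻²) = K̂`
    have h5 : Gs s = Pg (s ^ 2)⁻¹ / (yb (s ^ 2)⁻¹ + y₁) ^ 2
        * Real.sqrt ((s ^ 2)⁻¹ * τ (τ (s ^ 2)⁻¹)) / τ (s ^ 2)⁻¹ := by
      rw [← h2, hsq, hGs', hPg', hyb', h1, hden, hKh', hMh']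
      field_simp
      ring
    exact ⟨h1, h2, hDs, h4, h5⟩
  ---------------------------------------------------------------------------------------------
  -- (ii) continuity on `[0, s₁]`
  ---------------------------------------------------------------------------------------------
  have hRc : Continuous R := by rw [hR]; fun_prop
  have hMhc : Continuous Mh := by rw [hMh]; fun_prop
  have hDlc : Continuous Dl := by rw [hDl]; fun_prop
  have hNtc : Continuous Nt := by rw [hNt]; fun_prop
  have hA1c : Continuous A₁ := by rw [hA1]; fun_prop
  have hKhc : Continuous Kh := by rw [hKh]; fun_prop
  have hfc : Continuous f := by rw [hf']; fun_prop
  have hybc : Continuous yb := by rw [hyb]; fun_prop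
  have hslc : Continuous sl := by
    rw [hsl]
    exact Continuous.div (by fun_prop) (by fun_prop) hybne
  have hτc : Continuous τ := by rw [hτ]; fun_prop
  have hτhc : ContinuousOn τh (Icc 0 s₁) := by
    rw [hτh]
    exact (hNtc.continuousOn.div (by fun_prop) fun s hs =>
      mul_ne_zero four_ne_zero (pow_ne_zero 2 (hDne s hs))).sub continuousOn_const
  have hQhc : ContinuousOn Qh (Icc 0 s₁) := by
    rw [hQh]
    refine ContinuousOn.sub ?_ ?_
    · exact ContinuousOn.div (by fun_prop) (by fun_prop) fun s hs => mul_ne_zero two_ne_zero (hDne s hs)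
    · exact ((hfc.comp_continuousOn hτhc).sqrt).div (continuousOn_const.mul hτhc) fun s hs =>
        mul_ne_zero two_ne_zero (hτhne s hs)
  have hGsc : ContinuousOn Gs (Icc 0 s₁) := by
    rw [hGs]
    exact (hKhc.continuousOn.mul ((hτc.comp_continuousOn hτhc).sqrt)).div
      ((hDlc.continuousOn.pow 2).mul hτhc) fun s hs =>
        mul_ne_zero (pow_ne_zero 2 (hDne s hs)) (hτhne s hs)
  ---------------------------------------------------------------------------------------------
  -- (iii) values at `s = 0`
  ---------------------------------------------------------------------------------------------
  have hR0 : R 0 = 2 := by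
    rw [hR', show (4:ℝ) - g₂ * 0 ^ 4 - g₃ * 0 ^ 6 = 2 ^ 2 by norm_num, Real.sqrt_sq zero_le_two]
  have hDl0 : Dl 0 = 2 := by rw [hDl', hR0]; norm_num
  have hτh0 : τh 0 = x₁ := by rw [hτh', hNt', hDl0, hR0]; ring
  have hQh0 : Qh 0 = y₁ / (2 * x₁) := by
    rw [hQh', hτh0, ← hy1, Real.sqrt_sq_eq_abs, abs_of_neg hy1n]; ring
  have hGs0 : Gs 0 = -2 * Real.sqrt (τ x₁) / x₁ := by
    rw [hGs', hKh', hτh0, hDl0, hR0, div_eq_div_iff (by positivity) hx1.ne']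
    ring
  ---------------------------------------------------------------------------------------------
  -- (iv) semialgebraicity on the slab `{t | t 0 ∈ [0, s₁]}`
  ---------------------------------------------------------------------------------------------
  set S : Set (Fin 1 → ℝ) := {t | t 0 ∈ Icc 0 s₁} with hSdef
  have as₁ : IsAlgebraic ℚ s₁ :=
    IsAlgebraic.of_pow two_pos (by rw [eq_inv_of_mul_eq_one_left hs1x]; exact ax₁.inv)
  have hS : IsSemialgebraic ℚ S := cornerLower_isSemialgebraic_slab isAlgebraic_zero as₁
  have memS : ∀ t ∈ S, t 0 ∈ Icc (0:ℝ) s₁ := fun t ht => ht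
  have cst : ∀ {c : ℝ}, IsAlgebraic ℚ c → IsSemialgebraicFunOn ℚ S (fun _ => c) := fun hc =>
    isSemialgebraicFunOn_const_of_isAlgebraic hS hc
  have alg : ∀ n : ℕ, IsAlgebraic ℚ (n : ℝ) := fun n => isAlgebraic_nat n
  have aL₁ : IsAlgebraic ℚ L₁ := by
    rw [hL1, div_eq_mul_inv]
    exact (((alg 12).mul (ax₁.pow 2)).sub ag₂).mul ((alg 2).mul ay₁).inv
  have hT : IsSemialgebraicFunOn ℚ S (fun t => t 0) :=
    (isSemialgebraicFunOn_aeval hS (MvPolynomial.X 0)).congr fun x _ => by simp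
  have hDposS : ∀ t ∈ S, 0 < Dl (t 0) := fun t ht => hDlpos _ (memS t ht)
  have hτposS : ∀ t ∈ S, 0 < τh (t 0) := fun t ht => (hτpos _ (memS t ht)).1
  have sR : IsSemialgebraicFunOn ℚ S (fun t => R (t 0)) := by
    simp only [hR]
    exact (((cst (alg 4)).fun_sub ((cst ag₂).fun_mul (hT.fun_pow 4))).fun_sub
      ((cst ag₃).fun_mul (hT.fun_pow 6))).fun_sqrt
  have sMh : IsSemialgebraicFunOn ℚ S (fun t => Mh (t 0)) := by
    simp only [hMh]
    exact ((cst (alg 4)).fun_add ((cst ((alg 4).mul ax₁)).fun_mul (hT.fun_pow 2))).fun_add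
      ((cst (((alg 4).mul (ax₁.pow 2)).sub ag₂)).fun_mul (hT.fun_pow 4))
  have sDl : IsSemialgebraicFunOn ℚ S (fun t => Dl (t 0)) := by
    simp only [hDl]
    exact sR.fun_sub ((cst ay₁).fun_mul (hT.fun_pow 3))
  have sNt : IsSemialgebraicFunOn ℚ S (fun t => Nt (t 0)) := by
    simp only [hNt]
    exact ((((cst ((alg 32).mul ax₁)).fun_add
      ((cst ((alg 4).mul (((alg 12).mul (ax₁.pow 2)).sub ag₂))).fun_mul (hT.fun_pow 2))).fun_add
      (((cst ((alg 8).mul ay₁)).fun_mul hT).fun_mul sR)).fun_add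
      ((cst ((((alg 16).mul (ax₁.pow 3)).sub (((alg 4).mul ag₂).mul ax₁)).add
        ((alg 8).mul ag₃))).fun_mul (hT.fun_pow 4))).fun_add
      ((cst ((((alg 4).mul (ax₁.pow 2)).sub ag₂).pow 2)).fun_mul (hT.fun_pow 6))
  have sτh : IsSemialgebraicFunOn ℚ S (fun t => τh (t 0)) := by
    simp only [hτh]
    exact (sNt.div ((cst (alg 4)).fun_mul (sDl.fun_pow 2)) fun t ht =>
      mul_ne_zero four_ne_zero (pow_ne_zero 2 (hDposS t ht).ne')).fun_sub (cst ax₁)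
  have sfτh : IsSemialgebraicFunOn ℚ S (fun t => f (τh (t 0))) :=
    ((((cst (alg 4)).fun_mul (sτh.fun_pow 3)).fun_sub ((cst ag₂).fun_mul sτh)).fun_sub
      (cst ag₃)).congr fun t _ => (hf _).symm
  have sA1 : IsSemialgebraicFunOn ℚ S (fun t => A₁ (t 0)) := by
    simp only [hA1]
    exact (((cst ((alg 4).neg.mul ax₁)).fun_sub (((cst ay₁).fun_mul hT).fun_mul sR)).fun_sub
      ((cst ((alg 4).mul (ax₁.pow 2))).fun_mul (hT.fun_pow 2))).fun_sub
      ((cst ag₃).fun_mul (hT.fun_pow 4))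
  have sM : IsSemialgebraicFunOn ℚ S
      (fun t => 4 * τh (t 0) ^ 2 + 4 * τh (t 0) * x₁ + 4 * x₁ ^ 2 - g₂) :=
    ((((cst (alg 4)).fun_mul (sτh.fun_pow 2)).fun_add (((cst (alg 4)).fun_mul sτh).fun_mul
      (cst ax₁))).fun_add (cst ((alg 4).mul (ax₁.pow 2)))).fun_sub (cst ag₂)
  have ssl : IsSemialgebraicFunOn ℚ S (fun t => (4 * τh (t 0) ^ 2 + 4 * τh (t 0) * x₁
      + 4 * x₁ ^ 2 - g₂) / (-Real.sqrt (f (τh (t 0))) + y₁)) :=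
    sM.div (sfτh.fun_sqrt.fun_neg.fun_add (cst ay₁)) fun t _ => hnegden _
  have sττh : IsSemialgebraicFunOn ℚ S (fun t => τ (τh (t 0))) := by
    simp only [hτ, hsl, hyb]
    exact (((ssl.fun_pow 2).div (cst (alg 4)) fun _ _ => four_ne_zero).fun_sub sτh).fun_sub
      (cst ax₁)
  have sKh : IsSemialgebraicFunOn ℚ S (fun t => Kh (t 0)) := by
    simp only [hKh]
    exact (((((cst (alg 4).neg).fun_mul sR).fun_sub (((cst aL₁).fun_mul hT).fun_mul sMh)).fun_sub
      (((cst ((alg 8).mul ax₁)).fun_mul (hT.fun_pow 2)).fun_mul sR)).fun_add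
      ((cst ((alg 4).mul ay₁)).fun_mul (hT.fun_pow 3))).fun_add
      ((cst (((alg 8).mul ax₁).mul ay₁)).fun_mul (hT.fun_pow 5))
  have sQh : IsSemialgebraicFunOn ℚ S (fun t => Qh (t 0)) := by
    simp only [hQh]
    exact ((hT.fun_mul sA1).div ((cst (alg 2)).fun_mul sDl) fun t ht =>
      mul_ne_zero two_ne_zero (hDposS t ht).ne').fun_sub
      (sfτh.fun_sqrt.div ((cst (alg 2)).fun_mul sτh) fun t ht =>
        mul_ne_zero two_ne_zero (hτposS t ht).ne')
  have sGs : IsSemialgebraicFunOn ℚ S (fun t => Gs (t 0)) := by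
    simp only [hGs]
    exact (sKh.fun_mul sττh.fun_sqrt).div ((sDl.fun_pow 2).fun_mul sτh) fun t ht =>
      mul_ne_zero (pow_ne_zero 2 (hDposS t ht).ne') (hτposS t ht).ne'
  exact ⟨part1, ⟨hRc.continuousOn, hτhc, hQhc, hGsc⟩, ⟨hR0, hτh0, hQh0, hGs0, hDl0⟩,
    sR, sτh, sQh, sGs⟩

end Summit.KontsevichZagierPeriods.KontsevichZagierPeriods.Cruxes.NeronTorsionSector.Translation

end
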